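import Mathlib
import Summits.NavierStokesRegularity.NavierStokesRegularity.Theorems.TaoLadderRungTwoFlatCoreRowGauge
import Summits.NavierStokesRegularity.NavierStokesRegularity.Theorems.TaoLadderRungTwoFlatCoreRowAnchor
import HarnessLib

/-!
# CORE ROW 56 (part 3 of 3) — theory-1 g44's cure of TRAP #14 (the core row gain in `HopTube.core_hop_flat_closed`): L-56b, the re-composed core landing and core hop — coefficient of the core datum `B` is `ρ` once
  (helper for the K_A♭ parent item stmt-NavierStokesRegularity-22987 `FlatGapCertificatesV2`, children 1A/2A of route
  TaoLadderRungTwoFlat; cell harvest/h2-tao-ladder, theory-1 g44, memo numT56/CORE-ROW-56 / LADDER §56)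

PROVENANCE (p1 g23): theory-1 g44's image of record numT56/CoreRow56.lean sha16 0faf4d271a46ab3c (747 l., farm `lean check`
rc 0 · 0 sorry · 0 warnings · axioms propext/Classical.choice/Quot.sound), landed with declarations BYTE-IDENTICAL in THREE
modules (400-line lint): part 1 `…CoreRowGauge` (L-56a: `QuadPolar.gauge_abs_accel_le_of_sup`, `gauge_abs_taylor_le_of_sup`,
`MirrorPulse.gauge_abs_quadTermOn_sub_time_le_of_sup`, `landing_at_section_time_gauge`), part 2 `…CoreRowAnchor` (L-56c:
`MirrorPulse.anchored_landing_site`, `core_phase_landing_flat_anchored`), part 3 `…CoreRowSharp` (L-56b: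
`HopTube.isWindowRegular_geomGauge_shift`, `geomGauge_pred_le_headGauge`, `core_landing_at_section_time_sharp`,
`core_hop_flat_closed_sharp`). This is part 3. The image's module docstring follows verbatim.

# numT56 (theory-1 g44, cell harvest/h2-tao-ladder): the CORE ROW of the flat tube WITHOUT the two gain artefacts
  (trap-candidate #14 "core row gain" in `HopTube.core_hop_flat_closed`; cures L-56a/b/c; helper material for the K_A♭
  parent item stmt-NavierStokesRegularity-22987 `FlatGapCertificatesV2`, children 1A/2A of route TaoLadderRungTwoFlat)

THE TRAP. The landed composition `HopTube.core_hop_flat_closed` (p1 g22) is a true theorem whose budget cannot be met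
along a ladder with a non-growing tube: its `CoreClause (n+1)` costs `a·δ(n+1) ≥ η̄₁·(1 + M_ω/(ω₀A_*)) ≥ 2·η̄₁` with
`η̄₁ ≥ D ≥ C_conv·ρ·B`, `C_conv = max(g, b^{K+1}) ≥ 4`, so the per-hop factor on the core datum is `≥ 2·C_conv·ρ ≥ 8ρ`
(`ρ ≈ 0.61` certified-scale float, E-T46-hop): two bookkeeping losses, each alone fatal —
(L1) GAUGE ROUND TRIP: the contraction-gauge landing (`core_phase_landing_flat`, leading term `ρB`) is converted to a
  UNIFORM head-gauge datum (`× C_conv`) only because `MirrorPulse.landing_at_section_time` is typed in the head gauge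
  (window-ADMISSIBLE), and converted back in `core_landing_at_section_time` (losing nothing more);
(L2) ANCHOR READ-OFF: the anchor-scale mismatch is fed with the UNIFORM landing error `η̄₁/ω₀`, although at the anchor
  site the corrected deviation vanishes EXACTLY (`anchorCoeff_spec`): the anchor datum is second order.

THE CURES (this file, kernel-checked against the tree):
* L-56a `QuadPolar.gauge_abs_accel_le_of_sup`, `gauge_abs_taylor_le_of_sup`, `MirrorPulse.gauge_abs_quadTermOn_sub_time_le_of_sup`,
  `MirrorPulse.landing_at_section_time_gauge` — the section-time step in ANY window-REGULAR gauge (mixed sup/gauge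
  bounds replace admissibility), in SITE FORM (the leading term is the site's own landing datum); applied in the
  shifted contraction gauge `ω♯_m = geomGauge(m−1)` (`Λ = max(g,b)`) there is no conversion constant at all;
* L-56c `MirrorPulse.anchored_landing_site`, `core_phase_landing_flat_anchored` — the phase landing with the extra
  ANCHOR clause `ω₀|X_{i₀,1}(τ) − κΦ_{i₀,1}(τ+h)| ≤ 12C_aB²‖T♭‖₁²g²M_w³` (pure second order);
* L-56b `HopTube.core_landing_at_section_time_sharp`, `HopTube.core_hop_flat_closed_sharp` — the re-composed core hop:
  budget `(E + S) + ((E_a + S)/ω₀/A_*)·M_ω ≤ a·δ(n+1)` with `E ≥ ρB + (1+q)Rem + 12C_aB²G` entering ONCE, `E_a = 12C_aB²G`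
  and `S = O(C_aB² + C_aB·E)`: the coefficient of `B` is `ρ` — the certified contraction rate, undiluted.

HONEST FRAMING: conditional estimates about MODEL-lattice solutions (Tao 2016 §4 vocabulary on `S♭`, `mirrorTable ε ε`,
m = 2); the anchored contraction (S2) and all bounds are HYPOTHESES; desk floats quoted above are UNSEALED; nothing
certified; no item closed; nothing about the Navier–Stokes equations.
-/

noncomputable section

-- the sub-problem namespace repeats the summit name by design (D-0017)
set_option linter.dupNamespace false

namespace Summit.NavierStokesRegularity.NavierStokesRegularity.Theorems

open Set Filter Literature.Analysis.FluidPDE Literature.Analysis.FluidPDE.TaoCascade QuadPolar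
open scoped Topology

/-! ## L-56b: the re-composed CORE LANDING and CORE HOP, no gauge round trip, second-order anchor read-off -/

namespace HopTube

open Finset MirrorPulse

/-- The SHIFTED contraction gauge `ω♯_{i,m} := geomGauge g b i (m−1)` (physical shell `m` weighted as read-out index
`m−1`) is window-regular with `Λ = max g b`. [folklore; cell harvest/h2-tao-ladder numT56 L-56b, gauge bookkeeping] -/
theorem isWindowRegular_geomGauge_shift {g b : ℝ} (hg : 1 ≤ g) (hb : 1 ≤ b) :
    QuadPolar.IsWindowRegular (fun (i : Fin 2) (m : ℤ) => geomGauge g b i (m - 1)) (max g b) := by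
  obtain ⟨hpos, hΛ, hreg⟩ := isWindowRegular_geomGauge hg hb
  exact ⟨fun i m => hpos i (m - 1), hΛ, fun i j n k hk => hreg i j (n - 1) (k - 1) ⟨by omega, by omega⟩⟩

/-- In the shifted contraction gauge a head-gauge bound is still a bound: `geomGauge(m−1) ≤ g^{m⁺}` (`g, b ≥ 1`).
[folklore; cell harvest/h2-tao-ladder numT56 L-56b, gauge bookkeeping] -/
theorem geomGauge_pred_le_headGauge {g b : ℝ} (hg : 1 ≤ g) (hb : 1 ≤ b) (i : Fin 2) (m : ℤ) :
    geomGauge g b i (m - 1) ≤ headGauge g i m := by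
  have h1 := geomGauge_le_succ hg hb i (m - 1)
  rw [sub_add_cancel] at h1
  exact h1.trans (geomGauge_le_headGauge (by linarith) hb i m)

/-- **CORE LANDING AT THE SECTION TIME, SHARP (cure L-56b).** As `core_landing_at_section_time`, but fed DIRECTLY with
the contraction-gauge landing data of the phase landing — `ω_k|X_{k+1}(τ) − κΦ_{k+1}(τ+h)| ≤ E` on `k ≥ −K−1` and the
anchor clause `ω₀|X_{i₀,1}(τ) − κΦ_{i₀,1}(τ+h)| ≤ E_a` — through `landing_at_section_time_gauge` in the shifted
contraction gauge (no `C_conv`) and `anchorScale_mismatch_le` with the ANCHOR-SITE error (not the uniform one):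
budget `(E + S) + ((E_a + S)/ω₀/A_*)·M_ω ≤ a·δ(n+1)`, `S = 2‖T♭‖₁²M²Λ²(M_X + 2|κ|M_w)h² + |h|(|κ||1−κ|‖T♭‖₁MΛM_w +
2‖T♭‖₁|κ|MΛE + ‖T♭‖₁(1+|κ|)MΛE)`, `Λ = max(g,b)`, gives `CoreClause P i₀ u⋆ (n+1) (recentre X (τ − h) a)`.
[cite: Tao2016AveragedNS, §6.3–6.4 (statement shape of the checkpoint step: re-centring and modulation); cell harvest/h2-tao-ladder numT56 L-56b (cf. `core_landing_at_section_time`)] -/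
theorem core_landing_at_section_time_sharp (P : TubeSchedule) {ε : ℝ} {Φ X : Fin 2 → ℤ → ℝ → ℝ} {i₀ : Fin 2}
    {M Mw MX E Ea κ h τ a Mω : ℝ} {n : ℕ}
    (hΦ : IsGlobalSol ε Φ) (hX : IsGlobalSol ε X) (hg : 1 ≤ P.g) (hb : 1 ≤ P.b) (hA : 0 < P.Astar)
    (hΦb : ∀ i m t, |Φ i m t| ≤ M) (hXb : ∀ i m t, |X i m t| ≤ M)
    (hMw : 0 ≤ Mw) (hΦg : ∀ j k, ∀ t ∈ Icc (τ - 1) (τ + 1), headGauge P.g j k * |Φ j k t| ≤ Mw)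
    (hMX : 0 ≤ MX) (hXg : ∀ j k, ∀ t ∈ Icc (τ - 1) (τ + 1), headGauge P.g j k * |X j k t| ≤ MX)
    (hh : |h| ≤ 1) (hκ : 0 ≤ κ) (hE0 : 0 ≤ E) (hΦa : Φ i₀ 1 τ ≠ 0)
    (hE : ∀ (i : Fin 2) (k : ℤ), -(P.K : ℤ) - 1 ≤ k →
      geomGauge P.g P.b i k * |X i (k + 1) τ - κ * Φ i (k + 1) (τ + h)| ≤ E)
    (hEa : geomGauge P.g P.b i₀ 0 * |X i₀ 1 τ - κ * Φ i₀ 1 (τ + h)| ≤ Ea)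
    (hMω : ∀ (i : Fin 2) (k : ℤ), -(P.K : ℤ) ≤ k →
      geomGauge P.g P.b i k * |sectionState P.Astar i₀ (fun i k => Φ i (1 + k) τ) i k| ≤ Mω)
    (ha : 0 < a)
    (hbudget :
      (E + (2 * (tableAbsSum shiftSetFlat (mirrorTable ε ε)) ^ 2 * M ^ 2 * (max P.g P.b) ^ 2
              * (MX + 2 * |κ| * Mw) * h ^ 2
            + |h| * (|κ| * |1 - κ| * (tableAbsSum shiftSetFlat (mirrorTable ε ε) * M * max P.g P.b * Mw)
              + 2 * tableAbsSum shiftSetFlat (mirrorTable ε ε) * (|κ| * M) * max P.g P.b * E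
              + tableAbsSum shiftSetFlat (mirrorTable ε ε) * ((1 + |κ|) * M) * max P.g P.b * E)))
      + ((Ea + (2 * (tableAbsSum shiftSetFlat (mirrorTable ε ε)) ^ 2 * M ^ 2 * (max P.g P.b) ^ 2
              * (MX + 2 * |κ| * Mw) * h ^ 2
            + |h| * (|κ| * |1 - κ| * (tableAbsSum shiftSetFlat (mirrorTable ε ε) * M * max P.g P.b * Mw)
              + 2 * tableAbsSum shiftSetFlat (mirrorTable ε ε) * (|κ| * M) * max P.g P.b * E
              + tableAbsSum shiftSetFlat (mirrorTable ε ε) * ((1 + |κ|) * M) * max P.g P.b * E)))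
          / geomGauge P.g P.b i₀ 0 / P.Astar) * Mω ≤ a * P.δ (n + 1)) :
    CoreClause P i₀ (sectionState P.Astar i₀ (fun i k => Φ i (1 + k) τ)) (n + 1) (recentre X (τ - h) a) := by
  -- abbreviation for the second-order part (opaque with its defining equation)
  obtain ⟨S, hS⟩ : ∃ S : ℝ, S =
      2 * (tableAbsSum shiftSetFlat (mirrorTable ε ε)) ^ 2 * M ^ 2 * (max P.g P.b) ^ 2 * (MX + 2 * |κ| * Mw) * h ^ 2
        + |h| * (|κ| * |1 - κ| * (tableAbsSum shiftSetFlat (mirrorTable ε ε) * M * max P.g P.b * Mw)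
          + 2 * tableAbsSum shiftSetFlat (mirrorTable ε ε) * (|κ| * M) * max P.g P.b * E
          + tableAbsSum shiftSetFlat (mirrorTable ε ε) * ((1 + |κ|) * M) * max P.g P.b * E) := ⟨_, rfl⟩
  rw [← hS] at hbudget
  have hg0 : 0 ≤ P.g := by linarith
  have hω₀ : 0 < geomGauge P.g P.b i₀ 0 := geomGauge_pos (by linarith) (by linarith) i₀ 0
  -- the shifted contraction gauge and the data in it
  have hw := isWindowRegular_geomGauge_shift hg hb
  have hΦg' : ∀ j k, ∀ t ∈ Icc (τ - 1) (τ + 1),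
      (fun (i : Fin 2) (m : ℤ) => geomGauge P.g P.b i (m - 1)) j k * |Φ j k t| ≤ Mw := fun j k t ht =>
    (mul_le_mul_of_nonneg_right (geomGauge_pred_le_headGauge hg hb j k) (abs_nonneg _)).trans (hΦg j k t ht)
  have hXg' : ∀ j k, ∀ t ∈ Icc (τ - 1) (τ + 1),
      (fun (i : Fin 2) (m : ℤ) => geomGauge P.g P.b i (m - 1)) j k * |X j k t| ≤ MX := fun j k t ht =>
    (mul_le_mul_of_nonneg_right (geomGauge_pred_le_headGauge hg hb j k) (abs_nonneg _)).trans (hXg j k t ht)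
  have hD : ∀ (j : Fin 2) (m : ℤ), -(P.K : ℤ) ≤ m →
      (fun (i : Fin 2) (m : ℤ) => geomGauge P.g P.b i (m - 1)) j m * |X j m τ - κ * Φ j m (τ + h)| ≤ E := by
    intro j m hm
    have h1 := hE j (m - 1) (by omega)
    rw [sub_add_cancel] at h1
    exact h1
  -- (1) landing closeness to `κΦ₀` in the contraction gauge on `k ≥ −K`, site form
  have hsite : ∀ (i : Fin 2) (k : ℤ), -(P.K : ℤ) ≤ k →
      geomGauge P.g P.b i k * |X i (1 + k) (τ - h) - κ * Φ i (1 + k) τ|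
        ≤ geomGauge P.g P.b i k * |X i (1 + k) τ - κ * Φ i (1 + k) (τ + h)| + S := by
    intro i k hk
    have h1 := landing_at_section_time_gauge (e := -(P.K : ℤ)) hΦ hX hw hΦb hXb hMw hΦg' hMX hXg' hh hE0
      hD i (1 + k) (by omega)
    simp only [add_sub_cancel_left] at h1
    linarith [h1, hS.le, hS.ge]
  have hland : ∀ (i : Fin 2) (k : ℤ), -(P.K : ℤ) ≤ k →
      geomGauge P.g P.b i k * |X i (1 + k) (τ - h) - κ * Φ i (1 + k) τ| ≤ E + S := by
    intro i k hk
    have h1 := hE i k (by omega)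
    rw [add_comm k 1] at h1
    linarith [hsite i k hk]
  -- (2) the reference IS a member of the section-state family: `κΦ₀ = x_r·u⋆`
  have hΦa' : (fun i k => Φ i (1 + k) τ) i₀ 0 ≠ 0 := by simpa using hΦa
  have href : ∀ (i : Fin 2) (k : ℤ), -(P.K : ℤ) ≤ k →
      geomGauge P.g P.b i k * |κ * Φ i (1 + k) τ
        - κ * |(fun i k => Φ i (1 + k) τ) i₀ 0| / P.Astar
          * sectionState P.Astar i₀ (fun i k => Φ i (1 + k) τ) i k| ≤ 0 := by
    intro i k _
    rw [refScale_mul_sectionState (Φ₀ := fun i k => Φ i (1 + k) τ) (i₀ := i₀) (κ := κ) hA.ne' hΦa' i k]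
    simp
  -- (3) the anchor-scale mismatch from the ANCHOR-SITE error (second order), not the uniform one
  have hanchor : |X i₀ (1 + 0) (τ - h) - κ * Φ i₀ (1 + 0) τ| ≤ (Ea + S) / geomGauge P.g P.b i₀ 0 := by
    rw [le_div_iff₀ hω₀, mul_comm]
    have h1 := hsite i₀ 0 (by omega)
    simp only [add_zero] at h1 ⊢
    linarith [hEa]
  have hx : abs (|X i₀ 1 (τ - h)| / P.Astar - κ * |(fun i k => Φ i (1 + k) τ) i₀ 0| / P.Astar)
      ≤ ((Ea + S) / geomGauge P.g P.b i₀ 0 + 0 / geomGauge P.g P.b i₀ 0) / P.Astar := by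
    have h1 := anchorScale_mismatch_le (δ₁ := 0) (ref₀ := κ * Φ i₀ (1 + 0) τ)
      (Φ₀₀ := (fun i k => Φ i (1 + k) τ) i₀ 0) hA hκ hω₀ hanchor (by simp)
    simpa only [add_zero] using h1
  -- (4) the landing wrapper
  refine core_landing_of_gauge_capture P ha hg hb (ref := fun i k => κ * Φ i (1 + k) τ) hland href hMω hx ?_
  have e0 : ((Ea + S) / geomGauge P.g P.b i₀ 0 + 0 / geomGauge P.g P.b i₀ 0) / P.Astar
      = (Ea + S) / geomGauge P.g P.b i₀ 0 / P.Astar := by rw [zero_div, add_zero]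
  rw [e0, add_zero]
  exact hbudget

/-- **THE CORE-ZONE HOP OF THE FLAT TUBE, CLOSED AND SHARP (cure L-56b; replaces the budget of `core_hop_flat_closed`).**
Same inputs as `core_hop_flat_closed` WITHOUT the conversion constant `C_conv`, WITHOUT the edge-shell datum, and with
the core landing bound `E ≥ ρB + (1+q)Rem + 12C_aB²G` (`G = ‖T♭‖₁²g²M_w³`) entering the budget ONCE:
`∃ τ₁, |τ₁ − τ| ≤ 2C_aB ∧ ∀ a > 0, (E + S̄) + ((12C_aB²G + S̄)/ω₀/A_*)·M_ω ≤ a·δ(n+1) → CoreClause … (recentre X τ₁ a)`,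
`S̄ = 2‖T♭‖₁²M²Λ²(M_X + 3M_w)(2C_aB)² + 2C_aB·((3/2)C_aB‖T♭‖₁MΛM_w + 3‖T♭‖₁MΛE + (5/2)‖T♭‖₁MΛE)` (monotone in the
unknown `(κ, h)`), `Λ = max(g,b)`. The coefficient of the core datum `B` in the row is `ρ` — undiluted.
[cite: Tao2016AveragedNS, §4 (4.8), §6.3–6.4 (statement shape of the checkpoint step: re-centring, modulation); cell harvest/h2-tao-ladder numT56 L-56b (cf. `core_hop_flat_closed`)] -/
theorem core_hop_flat_closed_sharp (P : TubeSchedule) {ε τ : ℝ} {Φ X : Fin 2 → ℤ → ℝ → ℝ} {i₀ : Fin 2}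
    {ρ C M Mw MX B B' q ηhat qbar rbar Rτ Qa φa CaB E Mω : ℝ} {n : ℕ}
    (hΦ : IsGlobalSol ε Φ) (hX : IsGlobalSol ε X) (hε : 0 ≤ ε) (hτ : 0 ≤ τ)
    (hg : 1 ≤ P.g) (hb : 1 ≤ P.b) (hA : 0 < P.Astar)
    (hΦb : ∀ i m t, |Φ i m t| ≤ M) (hXb : ∀ i m t, |X i m t| ≤ M)
    (hS2 : AnchoredHopContraction ε τ Φ (geomGauge P.g P.b) i₀ ρ C) (hq : 0 ≤ q)
    (hprof : ∀ (i : Fin 2) (k : ℤ), ¬(i = i₀ ∧ k = 0) →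
      geomGauge P.g P.b i k * |Φ i (k + 1) τ| ≤ q * (geomGauge P.g P.b i₀ 0 * |Φ i₀ 1 τ|))
    (hMw : 0 ≤ Mw) (hΦg : ∀ j k, ∀ t ∈ Icc (τ - 1) (τ + 1), headGauge P.g j k * |Φ j k t| ≤ Mw)
    (hMX : 0 ≤ MX) (hXg : ∀ j k, ∀ t ∈ Icc (τ - 1) (τ + 1), headGauge P.g j k * |X j k t| ≤ MX)
    (hB : ∀ i k, geomGauge P.g P.b i k * |truncFam (-(P.K : ℤ) - 1) (X - Φ) i k 0| ≤ B)
    (hB' : ∀ i k, headGauge P.g i k * |truncFam (-(P.K : ℤ) - 1) (X - Φ) i k 0| ≤ B')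
    (hηhat : 0 ≤ ηhat) (hVe : ∀ t ∈ Icc 0 τ, |Φ 1 (-(P.K : ℤ) - 1) t| ≤ ηhat)
    (hAe : ∀ t ∈ Icc 0 τ, |Φ 0 (-(P.K : ℤ) - 1 + 1) t| ≤ ηhat)
    (hqbar : 0 ≤ qbar) (hqh : ∀ t ∈ Icc 0 τ, |(X - Φ) 1 (-(P.K : ℤ) - 1) t| ≤ qbar)
    (hrbar : 0 ≤ rbar) (hrh : ∀ t ∈ Icc 0 τ, |(X - Φ) 0 (-(P.K : ℤ) - 1 + 1) t| ≤ rbar)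
    (hRτ : |(X - Φ) i₀ 1 τ| ≤ Rτ) (hQa : |quadTermOn shiftSetFlat 0 (mirrorTable ε ε) Φ i₀ 1 τ| ≤ Qa)
    (hφa : 0 < φa) (hφale : φa ≤ |Φ i₀ 1 τ|)
    (hCaB1 : C * B ≤ CaB) (hCaB2 : (Rτ + C * B * Qa) / φa ≤ CaB) (hCaB : CaB ≤ 1 / 2)
    (hEcore :
      (ρ * B + (1 + q) * ((tableAbsSum shiftSetFlat (mirrorTable ε ε) * P.g *
          ((B' + (qbar * (2 * ηhat + qbar + ε * (ηhat + rbar)) + rbar * (ηhat + ε * (2 * ηhat + rbar))) * τ)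
            * Real.exp (2 * tableAbsSum shiftSetFlat (mirrorTable ε ε) * M * P.g * τ)) ^ 2
          + (geomGauge P.g P.b 0 (-(P.K : ℤ) - 1 + 1) * (qbar * (2 * ηhat + qbar + ε * (ηhat + rbar)))
            + geomGauge P.g P.b 1 (-(P.K : ℤ) - 1) * (rbar * (ηhat + ε * (2 * ηhat + rbar))))) * τ *
          Real.exp (2 * tableAbsSum shiftSetFlat (mirrorTable ε ε) * M * max P.g P.b * τ)))
        + 12 * CaB ^ 2 * ((tableAbsSum shiftSetFlat (mirrorTable ε ε)) ^ 2 * P.g ^ 2 * Mw ^ 3) ≤ E)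
    (hMω0 : 0 ≤ Mω)
    (hMω : ∀ (i : Fin 2) (k : ℤ), -(P.K : ℤ) ≤ k →
      geomGauge P.g P.b i k * |sectionState P.Astar i₀ (fun i k => Φ i (1 + k) τ) i k| ≤ Mω) :
    ∃ τ₁ : ℝ, |τ₁ - τ| ≤ 2 * CaB ∧ ∀ a : ℝ, 0 < a →
      (E + (2 * (tableAbsSum shiftSetFlat (mirrorTable ε ε)) ^ 2 * M ^ 2 * (max P.g P.b) ^ 2
              * (MX + 2 * (3 / 2) * Mw) * (2 * CaB) ^ 2
            + (2 * CaB) * ((3 / 2) * CaB * (tableAbsSum shiftSetFlat (mirrorTable ε ε) * M * max P.g P.b * Mw)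
              + 2 * tableAbsSum shiftSetFlat (mirrorTable ε ε) * ((3 / 2) * M) * max P.g P.b * E
              + tableAbsSum shiftSetFlat (mirrorTable ε ε) * ((1 + 3 / 2) * M) * max P.g P.b * E)))
        + ((12 * CaB ^ 2 * ((tableAbsSum shiftSetFlat (mirrorTable ε ε)) ^ 2 * P.g ^ 2 * Mw ^ 3)
            + (2 * (tableAbsSum shiftSetFlat (mirrorTable ε ε)) ^ 2 * M ^ 2 * (max P.g P.b) ^ 2
                * (MX + 2 * (3 / 2) * Mw) * (2 * CaB) ^ 2
              + (2 * CaB) * ((3 / 2) * CaB * (tableAbsSum shiftSetFlat (mirrorTable ε ε) * M * max P.g P.b * Mw)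
                + 2 * tableAbsSum shiftSetFlat (mirrorTable ε ε) * ((3 / 2) * M) * max P.g P.b * E
                + tableAbsSum shiftSetFlat (mirrorTable ε ε) * ((1 + 3 / 2) * M) * max P.g P.b * E)))
            / geomGauge P.g P.b i₀ 0 / P.Astar) * Mω ≤ a * P.δ (n + 1) →
      CoreClause P i₀ (sectionState P.Astar i₀ (fun i k => Φ i (1 + k) τ)) (n + 1) (recentre X τ₁ a) := by
  have hM0 : 0 ≤ M := (abs_nonneg _).trans (hΦb 0 0 0)
  have hT0 : 0 ≤ tableAbsSum shiftSetFlat (mirrorTable ε ε) := tableAbsSum_nonneg _ _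
  have hg0 : 0 ≤ P.g := by linarith
  have hΛ0 : 0 ≤ max P.g P.b := le_max_of_le_left hg0
  have hω₀ : 0 < geomGauge P.g P.b i₀ 0 := geomGauge_pos (by linarith) (by linarith) i₀ 0
  have he : (-(P.K : ℤ) - 1) + 1 ≤ 0 := by omega
  -- the phase landing with the anchor clause
  obtain ⟨κ, h, hκ1, hh2, hκ0, hanch, hland⟩ := core_phase_landing_flat_anchored (e := -(P.K : ℤ) - 1) hΦ hX hε hτ
    he hΦb hXb hg hb hS2 hq hprof hMw hΦg hB hB' hηhat hVe hAe hqbar hqh hrbar hrh hRτ hQa hφa hφale hCaB1 hCaB2 hCaB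
  have hCaB0 : 0 ≤ CaB := (abs_nonneg _).trans hκ1
  have hh1 : |h| ≤ 1 := hh2.trans (by linarith)
  have hκabs : |κ| ≤ 3 / 2 := by
    have h1 := (abs_le.mp hκ1).2
    rw [abs_of_nonneg hκ0]; linarith
  have h1κ : |1 - κ| ≤ CaB := by rw [abs_sub_comm]; exact hκ1
  -- the contraction-gauge landing data, bounded by `E`
  have hE : ∀ (i : Fin 2) (k : ℤ), -(P.K : ℤ) - 1 ≤ k →
      geomGauge P.g P.b i k * |X i (k + 1) τ - κ * Φ i (k + 1) (τ + h)| ≤ E := fun i k hk =>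
    (hland i k hk).trans hEcore
  have hE0 : 0 ≤ E :=
    le_trans (mul_nonneg (geomGauge_pos (by linarith) (by linarith) i₀ 0).le (abs_nonneg _)) (hE i₀ 0 (by omega))
  have hΦa : Φ i₀ 1 τ ≠ 0 := by
    intro h0; rw [h0, abs_zero] at hφale; linarith
  refine ⟨τ - h, ?_, fun a ha hbudget => ?_⟩
  · have : τ - h - τ = -h := by ring
    rw [this, abs_neg]; exact hh2
  -- monotone budget: S(κ, h, E) ≤ S̄
  have hS : 2 * (tableAbsSum shiftSetFlat (mirrorTable ε ε)) ^ 2 * M ^ 2 * (max P.g P.b) ^ 2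
          * (MX + 2 * |κ| * Mw) * h ^ 2
        + |h| * (|κ| * |1 - κ| * (tableAbsSum shiftSetFlat (mirrorTable ε ε) * M * max P.g P.b * Mw)
          + 2 * tableAbsSum shiftSetFlat (mirrorTable ε ε) * (|κ| * M) * max P.g P.b * E
          + tableAbsSum shiftSetFlat (mirrorTable ε ε) * ((1 + |κ|) * M) * max P.g P.b * E)
      ≤ 2 * (tableAbsSum shiftSetFlat (mirrorTable ε ε)) ^ 2 * M ^ 2 * (max P.g P.b) ^ 2
          * (MX + 2 * (3 / 2) * Mw) * (2 * CaB) ^ 2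
        + (2 * CaB) * ((3 / 2) * CaB * (tableAbsSum shiftSetFlat (mirrorTable ε ε) * M * max P.g P.b * Mw)
          + 2 * tableAbsSum shiftSetFlat (mirrorTable ε ε) * ((3 / 2) * M) * max P.g P.b * E
          + tableAbsSum shiftSetFlat (mirrorTable ε ε) * ((1 + 3 / 2) * M) * max P.g P.b * E) := by
    rw [← sq_abs h]
    have hh0 : 0 ≤ |h| := abs_nonneg _
    gcongr
  have hk : 0 ≤ 1 / geomGauge P.g P.b i₀ 0 / P.Astar * Mω := by positivity
  have hS' := mul_le_mul_of_nonneg_right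
    (add_le_add_left hS (12 * CaB ^ 2 * ((tableAbsSum shiftSetFlat (mirrorTable ε ε)) ^ 2 * P.g ^ 2 * Mw ^ 3))) hk
  refine core_landing_at_section_time_sharp P hΦ hX hg hb hA hΦb hXb hMw hΦg hMX hXg hh1 hκ0 hE0 hΦa hE hanch hMω
    ha ?_
  have e1 : ∀ x : ℝ, x / geomGauge P.g P.b i₀ 0 / P.Astar * Mω
      = x * (1 / geomGauge P.g P.b i₀ 0 / P.Astar * Mω) := by
    intro x; ring
  rw [e1] at hbudget ⊢
  linarith [hbudget, hS, hS']

end HopTube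

end Summit.NavierStokesRegularity.NavierStokesRegularity.Theorems

end
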